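import Summits.BirchSwinnertonDyer.BirchSwinnertonDyer.Theorems.PrintCFramBottomClassIndexLawFiveLeBernoulliUnitsFourLifts
import Summits.BirchSwinnertonDyer.BirchSwinnertonDyer.Theorems.PrintCFramBottomClassIndexLawFiveLeHerbrandLineCharactersDirichlet
import HarnessLib

/-!
# Crux `PrintCFram.BottomClassIndexLawFiveLe` (stmt-BirchSwinnertonDyer-20372), line `eisenstein-resource-bdp-line` (registry v11 → v12):
# THE BERNOULLI UNITS OF THE KRIZ–LI DATUM, part D — T1 ∘ (Bernoulli units): FOR EVERY STABLE LINE `Φ` the Teichmüller lift `ψ₁`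
# of its character comes WITH its two Bernoulli units, its parity read on `b(−1)`, and the units of all four lifts
# (cell `bsd-print-cfram`, width seat `bsd-line-cfram-p1-w3` g4; THEOREMS ONLY, `--supports` 20372; BSD is not proved by any of this)

HONEST FRAMING. Nothing here is a statement about BSD; no stub of the skeleton is closed. LEAD g9's ROAD C (STATUS 17:46Z) splits the
Hom-form Stub H into D (dictionary) / O (odd vanishing ⟸ Mazur–Wiles) / E (even vanishing ⟸ Kummer reflection); this file is the
Dirichlet half of D glued to LEAD g8's T1 (`HerbrandLineCharacters.exists_dirichletCharacter_charSub_eq_or_eq_of_hss`): from Stub H's binders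
verbatim and a stable line `Φ ≤ W_K[p]` of order `p` with characters `θ_S, θ_Q`, ONE existential package — level `m`, `b : (ℤ/m)ˣ → 𝔽_pˣ`,
`ψ₁ = Teich ∘ b` with `θ_S = b∘χ_m∘res`, `θ_Q = χ̄_p·(b∘χ_m∘res)⁻¹`, the parity dictionary `ψ₁` odd ⟺ `b(−1) = −1`, the two units
`‖B_{1,ψ₁,₀⁻¹ε_K}‖ = ‖B_{1,ψ₁,₀ω⁻¹}‖ = 1`, and for EVERY lift `λ↑ ∈ {ψ₁↑, ψ₁↑ε_K↑, ψ₁⁻¹↑ω↑, ψ₁⁻¹↑ω↑ε_K↑}` its Bernoulli unit (odd: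
`‖bernoulliOnePrim λ⁻¹‖ = 1`; even: `‖bernoulliOnePrim (λ↑ω⁻¹↑)‖ = 1`).

* `teichmullerChar_neg_one` (`Teich(−1) = −1`, `p` odd), **`odd_iff_of_teichmuller_lift`** (`ψ₁` odd ⟺ `b(−1) = −1`, even ⟺ `b(−1) = 1`);
* **`lineCharacters_bernoulliUnits_of_heegner`** (the package above).

beyond-print theorem: NO. References: [KrizLi2019] Thm. 1.20, §7.1; [Mazur1978] Prop. 6.3 (1); [Washington1997] §5.1 (Teichmüller character);
LEAD g8 report §2–§4, LEAD g9 ROAD C plan (STATUS 2026-08-28T17:46Z).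
-/

set_option autoImplicit false
set_option linter.dupNamespace false

noncomputable section

open scoped Classical
open NumberField WeierstrassCurve Field
open DirichletCharacter Literature.NumberTheory.LFunctions Literature.NumberTheory.EllipticCurves.KrizLi2019
  Literature.NumberTheory.EllipticCurves Literature.NumberTheory.EllipticCurves.Rank1Residual
  Literature.NumberTheory.GaloisRepresentations
open Summit.BirchSwinnertonDyer.Rank1Residual

namespace Summit.BirchSwinnertonDyer.BirchSwinnertonDyer.Theorems.PrintCFram.BernoulliUnits

open Summit.BirchSwinnertonDyer.BirchSwinnertonDyer.Theorems.PrintCFram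

variable {p : ℕ} [hp : Fact p.Prime]

/-- **`Teich(−1) = −1`** for an odd prime `p`: `−1 ∈ ℤ_pˣ` is a `(p−1)`-th root of unity reducing to `−1`.
[cite: Washington1997, §5.1 (the Teichmüller character)] -/
theorem teichmullerChar_neg_one (hp2 : p ≠ 2) : Kato2004.teichmullerChar p (-1) = -1 := by
  symm
  apply Kato2004.eq_teichmullerChar
  · obtain ⟨k, hk⟩ := hp.out.even_sub_one hp2
    rw [hk, ← two_mul, pow_mul, neg_one_sq, one_pow]
  · rw [Units.val_neg, Units.val_one, map_neg, map_one, Units.val_neg, Units.val_one]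

/-- **Parity of the Teichmüller lift.** If `ψ₁(u) = Teich(b(u))` for all units `u` (LEAD g8's `ψ₁`), then `ψ₁` is ODD iff `b(−1) = −1`
and EVEN iff `b(−1) = 1` (`b(−1)² = 1` in `𝔽_pˣ`; `p` odd). With `b(−1) = r(c)` (`χ_m(c) = −1`, Galois side) this is the parity
dictionary of ROAD C's stub D. [cite: Washington1997, §5.1] [cite: KrizLi2019, §1.5 (p. 7)] -/
theorem odd_iff_of_teichmuller_lift (hp2 : p ≠ 2) {m : ℕ} [NeZero m] (b : (ZMod m)ˣ →* (ZMod p)ˣ)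
    {ψ₁ : DirichletCharacter ℚ_[p] m}
    (hψ₁ : ∀ u : (ZMod m)ˣ, ψ₁ (u : ZMod m) = (((Kato2004.teichmullerChar p (b u) : ℤ_[p]ˣ) : ℤ_[p]) : ℚ_[p])) :
    (ψ₁.Odd ↔ b (-1) = -1) ∧ (ψ₁.Even ↔ b (-1) = 1) := by
  have hval : ψ₁ (-1) = (((Kato2004.teichmullerChar p (b (-1)) : ℤ_[p]ˣ) : ℤ_[p]) : ℚ_[p]) := by
    have h := hψ₁ (-1)
    rwa [Units.val_neg, Units.val_one] at h
  haveI : Fact (2 < p) := ⟨lt_of_le_of_ne hp.out.two_le (Ne.symm hp2)⟩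
  have hne : (-1 : (ZMod p)ˣ) ≠ 1 := fun h => ZMod.neg_one_ne_one (Units.ext_iff.mp h)
  have h2Q : (-1 : ℚ_[p]) ≠ 1 := fun h => by
    have : (2 : ℚ_[p]) = 0 := by linear_combination -h
    exact two_ne_zero this
  -- `b(−1) = ±1`
  have hsq : b (-1) = 1 ∨ b (-1) = -1 := by
    have h1 : (b (-1)) ^ 2 = 1 := by rw [← map_pow, neg_one_sq, map_one]
    have h2 : ((b (-1) : (ZMod p)ˣ) : ZMod p) ^ 2 = 1 := by
      rw [← Units.val_pow_eq_pow_val, h1, Units.val_one]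
    rcases sq_eq_one_iff.mp h2 with h | h
    · exact Or.inl (Units.ext h)
    · exact Or.inr (Units.ext (by rw [h, Units.val_neg, Units.val_one]))
  unfold DirichletCharacter.Odd DirichletCharacter.Even
  rcases hsq with h | h
  · have hv : ψ₁ (-1) = 1 := by rw [hval, h, map_one, Units.val_one, PadicInt.coe_one]
    rw [hv, h]
    exact ⟨⟨fun h' => absurd h'.symm h2Q, fun h' => absurd h'.symm hne⟩, ⟨fun _ => rfl, fun _ => rfl⟩⟩
  · have hv : ψ₁ (-1) = -1 := by
      rw [hval, h, teichmullerChar_neg_one hp2, Units.val_neg, Units.val_one, PadicInt.coe_neg, PadicInt.coe_one]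
    rw [hv, h]
    exact ⟨⟨fun _ => rfl, fun _ => rfl⟩, ⟨fun h' => absurd h' h2Q, fun h' => absurd h' hne⟩⟩

variable (W : WeierstrassCurve ℚ) [W.IsElliptic] [W.IsGloballyMinimal]

/-- **T1 ∘ BERNOULLI UNITS: the line character's lift with all its Dirichlet-side data (ROAD C, stub D, Dirichlet half).**
For `W/ℚ` globally minimal with CM, `p ≥ 5` CM-ramified, a Heegner field `K` of `N = N_W`, Kriz–Li's `(f, ψ, ω, ε_K)` with `hss`,
`IsKroneckerCharacterOf K ε_K` and (4), and ANY stable line `Φ ≤ W_K[p]` of order `p` with characters `θ_S`, `θ_Q`: there are `m`,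
`b : (ℤ/m)ˣ → 𝔽_pˣ` and `ψ₁` (level `m`) with `θ_S = b∘χ_m∘res`, `θ_Q = χ̄_p·(b∘χ_m∘res)⁻¹`, `ψ₁ = Teich ∘ b`, the parity dictionary
`ψ₁` odd ⟺ `b(−1) = −1` (even ⟺ `b(−1) = 1`), the two units `‖B_{1,ψ₁,₀⁻¹ε_K}‖_p = ‖B_{1,ψ₁,₀ω⁻¹}‖_p = 1`, and for every character `λ`
with `λ↑ ∈ {ψ₁↑, ψ₁↑ε_K↑, ψ₁⁻¹↑ω↑, ψ₁⁻¹↑ω↑ε_K↑}` at a common level: `λ` odd ⟹ `‖bernoulliOnePrim λ⁻¹‖ = 1`, `λ` even ⟹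
`‖bernoulliOnePrim (λ↑·ω⁻¹↑)‖ = 1`. [cite: KrizLi2019, Thm. 1.20 (pp. 7–8), §7.1 (p. 43)] [cite: Mazur1978, §5 and Prop. 6.3 (1) (p. 153)]
[cite: Washington1997, Thm. 14.1 and §5.1] -/
theorem lineCharacters_bernoulliUnits_of_heegner (hCM : W.HasCM) (hram : CMRamified W p) (h5 : 5 ≤ p)
    (N : ℕ) (K : Type) [Field K] [NumberField K]
    {f : ℕ} [NeZero f] (ψ : DirichletCharacter ℚ_[p] f) (ω : DirichletCharacter ℚ_[p] p)
    (εK : DirichletCharacter ℚ_[p] (NumberField.discr K).natAbs)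
    (hN : W.conductorNorm ℤ = N) (hK : IsImaginaryQuadratic K) (hH : SatisfiesHeegnerHypothesis N K)
    (hω : IsTeichmullerCharacter ω)
    (hss : ∀ ℓ : ℕ, ℓ.Prime → ¬ (ℓ ∣ p * W.conductorNorm ℤ) →
      ‖((W.LFunction ℓ : ℤ) : ℚ_[p]) - (ψ (ℓ : ZMod f) + ψ⁻¹ (ℓ : ZMod f) * ω (ℓ : ZMod p))‖ < 1)
    (hεK : IsKroneckerCharacterOf K εK)
    (h4 : ¬ ‖bernoulliOnePrim (bernoulliCharOne ψ εK) * bernoulliOnePrim (bernoulliCharTwo ψ εK ω)‖ ≤ (p : ℝ)⁻¹)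
    (Φ : X2.ResidualDevissageModules.StableSubgroup (absoluteGaloisGroup K) ((W.baseChange K).geomTorsion (p : ℤ)))
    (hcard : Nat.card Φ.Sub = p) {θS θQ : absoluteGaloisGroup K →* (ZMod p)ˣ}
    (hθS : ∀ (g : absoluteGaloisGroup K) (x : Φ.Sub), g • x = (((θS g : ZMod p).val : ℕ) : ℤ) • x)
    (hθQ : ∀ (g : absoluteGaloisGroup K) (y : Φ.Quot), g • y = (((θQ g : ZMod p).val : ℕ) : ℤ) • y) :
    ∃ (m : ℕ) (_ : NeZero m) (b : (ZMod m)ˣ →* (ZMod p)ˣ) (ψ₁ : DirichletCharacter ℚ_[p] m),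
      (∀ g : absoluteGaloisGroup K, θS g = b (modNCyclotomicCharacter ℚ m (absGaloisRestrict ℚ K g))) ∧
      (∀ g : absoluteGaloisGroup K, θQ g = modPCyclotomicCharacterZMod ℚ p (absGaloisRestrict ℚ K g) *
        (b (modNCyclotomicCharacter ℚ m (absGaloisRestrict ℚ K g)))⁻¹) ∧
      (∀ u : (ZMod m)ˣ, ψ₁ (u : ZMod m) = (((Kato2004.teichmullerChar p (b u) : ℤ_[p]ˣ) : ℤ_[p]) : ℚ_[p])) ∧
      ((ψ₁.Odd ↔ b (-1) = -1) ∧ (ψ₁.Even ↔ b (-1) = 1)) ∧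
      (‖bernoulliOnePrim (bernoulliCharOne ψ₁ εK)‖ = 1 ∧ ‖bernoulliOnePrim (bernoulliCharTwo ψ₁ εK ω)‖ = 1) ∧
      ∀ {n : ℕ} [NeZero n] (lam : DirichletCharacter ℚ_[p] n) {M' : ℕ} [NeZero M'] (hn : n ∣ M') (hm' : m ∣ M')
        (hd : (NumberField.discr K).natAbs ∣ M') (hpM' : p ∣ M') (_ : m * (NumberField.discr K).natAbs ∣ M')
        (_ : m * (NumberField.discr K).natAbs * p ∣ M'),
        (changeLevel hn lam = changeLevel hm' ψ₁ ∨ changeLevel hn lam = changeLevel hm' ψ₁ * changeLevel hd εK ∨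
          changeLevel hn lam = changeLevel hm' ψ₁⁻¹ * changeLevel hpM' ω ∨
          changeLevel hn lam = changeLevel hm' ψ₁⁻¹ * changeLevel hpM' ω * changeLevel hd εK) →
        (lam.Odd → ‖bernoulliOnePrim lam⁻¹‖ = 1) ∧
        (lam.Even → ‖bernoulliOnePrim (changeLevel (dvd_mul_right n p) lam * changeLevel (dvd_mul_left p n) ω⁻¹)‖ = 1) := by
  have hp2 : p ≠ 2 := by have := hp.out.two_le; omega
  obtain ⟨m, hmz, b, ψ₁, hf, hm, hpM, hS, hQ, hψ₁, e⟩ :=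
    HerbrandLineCharacters.exists_dirichletCharacter_charSub_eq_or_eq_of_hss p W K hCM h5 hram ψ ω hω hss hK.1 Φ hcard hθS hθQ
  haveI := hmz
  obtain ⟨-, hall⟩ := norm_bernoulliPair_eq_one_of_heegner W hCM hram h5 N K ψ ω εK hN hK hH hω hss h4
  refine ⟨m, hmz, b, ψ₁, hS, hQ, hψ₁, odd_iff_of_teichmuller_lift hp2 b hψ₁, hall ψ₁ hf hm hpM e, ?_⟩
  intro n _ lam M' _ hn hm' hd hpM' hmd hmdp el
  exact fourLifts_of_heegner W hCM hram h5 N K ψ ω εK hN hK hH hω hss hεK h4 ψ₁ hf hm hpM e lam hn hm' hd hpM' hmd hmdp el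

end Summit.BirchSwinnertonDyer.BirchSwinnertonDyer.Theorems.PrintCFram.BernoulliUnits

end
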